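import Summits.BirchSwinnertonDyer.BirchSwinnertonDyer.Theses.InertBadSignedBranches
import HarnessLib

/-!
# Route `InertBadSignedBranches` (rung K8): the join `Assembly`, closed by the kernel bridge

The route's assembly item
`Summit.BirchSwinnertonDyer.BirchSwinnertonDyer.Theses.InertBadSignedBranches.Assembly :=
  CccOneLawOnTypeIstarZero → InertBadOffType → InertBadAtThree → PrintReadingsInert →
    PublishedFactsInert → Summit.BirchSwinnertonDyer.Rank1Residual.X12.CMInertBad`
is exactly the Theorems-side bridge `CMRungInputs.cmInertBad_of_inputs` (p406906): at `p = 3` the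
residual crux `InertBadAtThree`; at `p ≥ 5` on the signed local type `(p, I₀*)` the landed O10
consumer `X12.O10.bsdp_of_hasSignedLocalType_IstarZero_of_valuation_of_readings` (p402929) fed with
C-cc-1 (`CccOneLawOnTypeIstarZero`), the print readings (`PrintReadingsInert`), the published facts
(`PublishedFactsInert`) and the period datum `Additive.periodRatio_of_mazur` (p404221), then
`Typed.missingPPartAt_of_bsdp`; off the type the residual crux `InertBadOffType`. Nothing is
asserted: the cruxes, readings and published facts stay hypotheses of `Assembly` itself; the cell
bsd-cm's class statement of record behind the `I₀*` branch is
`X12.O10.lowerHalfOnType_IstarZero_of_valuation_of_lowerReading_of_mazur` (p405275).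
[cite: Kobayashi2003, §4 (p. 8) and Thm. 7.4 (p. 13)] [cite: Kobayashi2013, Cor. 1.3–1.4]
[cite: Miller2011LMS, Def. 1.1]
-/

set_option autoImplicit false
set_option linter.dupNamespace false

namespace Summit.BirchSwinnertonDyer.BirchSwinnertonDyer.Theorems

/-- **The join of route `InertBadSignedBranches` holds**: C-cc-1 on the signed local type
`(p, I₀*)` (`p ≥ 5`), the two residual conjuncts (off-type, `p = 3`), the print readings and the
published facts imply the rung-K8 leaf `X12.CMInertBad`, by the kernel bridge
`CMRungInputs.cmInertBad_of_inputs` (p406906). [cite: Kobayashi2003, §4 (p. 8) and Thm. 7.4 (p. 13)]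
[cite: Miller2011LMS, Def. 1.1] -/
theorem inertBadSignedBranches_assembly_proof :
    Summit.BirchSwinnertonDyer.BirchSwinnertonDyer.Theses.InertBadSignedBranches.Assembly := by
  unfold Summit.BirchSwinnertonDyer.BirchSwinnertonDyer.Theses.InertBadSignedBranches.Assembly
  intro h₁ h₂ h₃ h₅ h₆
  exact Summit.BirchSwinnertonDyer.BirchSwinnertonDyer.Rank1Residual.CMRungInputs.cmInertBad_of_inputs
    h₁ h₂ h₃ h₅ h₆

end Summit.BirchSwinnertonDyer.BirchSwinnertonDyer.Theorems
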